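import Mathlib
import Summits.Ventures.PercRepro2.SepSplitPendantRoot

/-!
# The pendant-root monotonicity CANDIDATE (PM-ROOT), stated, and the pendant-root case of row 2′T23
(blind cell PercRepro2, mine-2 g50, 2026-08-29; `conjectures/MINE-2.md` M2-107 — a candidate of
record, NOT a theorem)

For a typed edge `e ∈ F` write `N_k := typedCount F z (τ[e := k]) K₃` (`k = 0, 1, 2, 3`; the other
types in `{1, 2}`).  Night-3's row 2′T23 (`TypedTwoDominates.T23`: `N₃ ≤ N₂` at every typed edge)
is a theorem at every REDUCIBLE edge given row 2′TRI one instance down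
(`TypedTwoDominatesRules`: unmarked leaf, loop, pendant `o` / `b`, root pair, pendant `a₃` modulo
(PM)); the pendant ROOT edge is the case not covered there — the root-leaf identity of
`TypedPendantRoot` is not a reduction rule.  **`PMRoot`** (the candidate; census M2-107: the weak
forms 0 / 179,672,960 class vectors, kit j334603; the strong form 0 / 133,680 on the hub, kit
j334701 at scale): with the root `a₁` a leaf at `f = {a₁, u}`, `u` unmarked, the LEAF-RULE VALUES
are lower bounds — `N₃ ≤ N₁` and `2·N₃ ≤ N₂` (equality exactly where the root behaves like the
marks `o, b`).  Consequences in the kernel: `typedCount_pendant_a1_of_PMRoot` — under (PM-ROOT),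
row 2′TRI on `G − a₁` (`0 ≤ N₃`) gives the typed pendant-root class `0 ≤ N₁`, `0 ≤ N₂`;
`t23_pendant_root_of_PMRoot` — (T23) at the pendant root edge given 2′TRI one instance down, the
missing case of night-3's list, conditional on the candidate; `orbitRootS_pendant_root_nonneg_of_PMRoot`
— hence the single-edge-bundle chain orbit sums with a far root are nonnegative
(`SepSplitPendantRoot`).  Own work; standard axioms; nothing here asserts the candidate.
-/

namespace Summit.Ventures.PercRepro2

open UnionCluster

namespace CovForm

namespace TypedRed

open OneTyped TypedA3

/-! ## The candidates -/

section Candidates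

/-- **The candidate (PM-ROOT)** — pendant-root monotonicity: with the root `a₁` a leaf at the typed
edge `f = {a₁, u}` and `u` unmarked, the contracted base is dominated by the type-`1` base and
twice by the type-`2` base, at every pinning and type vector (types in `{1, 2}` on `F`).
A CANDIDATE of record (M2-107), not a theorem. -/
def PMRoot (R : Type*) [Field R] [LinearOrder R] : Prop :=
  ∀ (V E : Type) [Fintype E] [DecidableEq E] (ends : E → Sym2 V) (o a₁ a₂ a₃ b u : V) (f : E),
    ends f = s(a₁, u) → (∀ e, a₁ ∈ ends e → e = f) →
    a₁ ≠ u → a₁ ≠ o → a₁ ≠ a₂ → a₁ ≠ a₃ → a₁ ≠ b → u ≠ o → u ≠ a₂ → u ≠ a₃ → u ≠ b →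
    ∀ (F : Finset E), f ∈ F → ∀ (z : Config E) (τ : E → ℕ), (∀ e ∈ F, τ e = 1 ∨ τ e = 2) →
      typedCount F z (Function.update τ f 3)
          (K3 ends o a₁ a₂ a₃ b : Config E → Config E → Config E → R) ≤
        typedCount F z (Function.update τ f 1) (K3 ends o a₁ a₂ a₃ b) ∧
      2 * typedCount F z (Function.update τ f 3)
          (K3 ends o a₁ a₂ a₃ b : Config E → Config E → Config E → R) ≤
        typedCount F z (Function.update τ f 2) (K3 ends o a₁ a₂ a₃ b)

end Candidates

/-! ## Consequences -/

section Consequences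

variable {V E : Type} [Fintype E] [DecidableEq E] {R : Type*} [Field R] [LinearOrder R]
  [IsStrictOrderedRing R]
variable (ends : E → Sym2 V) (o a₁ a₂ a₃ b : V)

/-- **The typed pendant-root class from (PM-ROOT) and row 2′TRI on `G − a₁`**: if the contracted
base is nonnegative, so are the type-`1` and type-`2` bases. -/
theorem typedCount_pendant_a1_of_PMRoot (hPM : PMRoot R) {f : E} {u : V} (hf : ends f = s(a₁, u))
    (hleaf : ∀ e, a₁ ∈ ends e → e = f) (h1u : a₁ ≠ u) (h1o : a₁ ≠ o) (h12 : a₁ ≠ a₂)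
    (h13 : a₁ ≠ a₃) (h1b : a₁ ≠ b) (huo : u ≠ o) (hu2 : u ≠ a₂) (hu3 : u ≠ a₃) (hub : u ≠ b)
    (F : Finset E) (hfF : f ∈ F) (z : Config E) (τ : E → ℕ) (hτ : ∀ e ∈ F, τ e = 1 ∨ τ e = 2)
    (h3 : 0 ≤ typedCount F z (Function.update τ f 3)
      (K3 ends o a₁ a₂ a₃ b : Config E → Config E → Config E → R)) :
    0 ≤ typedCount F z (Function.update τ f 1)
        (K3 ends o a₁ a₂ a₃ b : Config E → Config E → Config E → R) ∧
      0 ≤ typedCount F z (Function.update τ f 2)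
        (K3 ends o a₁ a₂ a₃ b : Config E → Config E → Config E → R) := by
  obtain ⟨h1, h2⟩ := hPM V E ends o a₁ a₂ a₃ b u f hf hleaf h1u h1o h12 h13 h1b huo hu2 hu3 hub
    F hfF z τ hτ
  exact ⟨h3.trans h1, (mul_nonneg (by norm_num : (0 : R) ≤ 2) h3).trans h2⟩

/-- **(T23) at a pendant root edge, given 2′TRI one instance down and (PM-ROOT)**: the base with
`f` pinned open is dominated by the type-`2` base — the case of night-3's reducible-edge list that
the root-leaf identity does not settle, conditional on the candidate. -/
theorem t23_pendant_root_of_PMRoot (hPM : PMRoot R) {f : E} {u : V} (hf : ends f = s(a₁, u))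
    (hleaf : ∀ e, a₁ ∈ ends e → e = f) (h1u : a₁ ≠ u) (h1o : a₁ ≠ o) (h12 : a₁ ≠ a₂)
    (h13 : a₁ ≠ a₃) (h1b : a₁ ≠ b) (huo : u ≠ o) (hu2 : u ≠ a₂) (hu3 : u ≠ a₃) (hub : u ≠ b)
    (F : Finset E) (hfF : f ∈ F) (z : Config E) (τ : E → ℕ) (hτ : ∀ e ∈ F, τ e = 1 ∨ τ e = 2)
    (h3 : 0 ≤ typedCount F z (Function.update τ f 3)
      (K3 ends o a₁ a₂ a₃ b : Config E → Config E → Config E → R)) :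
    typedCount F z (Function.update τ f 3)
        (K3 ends o a₁ a₂ a₃ b : Config E → Config E → Config E → R) ≤
      typedCount F z (Function.update τ f 2) (K3 ends o a₁ a₂ a₃ b) := by
  have h2 := (hPM V E ends o a₁ a₂ a₃ b u f hf hleaf h1u h1o h12 h13 h1b huo hu2 hu3 hub
    F hfF z τ hτ).2
  linarith

end Consequences

/-! ## The far-root orbits -/

section Orbits

open Classical RootBridge

variable {V E : Type} {ι : Type*} [Fintype E] [DecidableEq E] [Fintype ι] [DecidableEq ι]
  {R : Type*} [Field R] [LinearOrder R] [IsStrictOrderedRing R]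
variable (ends : E → Sym2 V) (mk : Fin 5 → V) (σ : ι → V)

/-- **The single-edge-bundle chain orbit with a far root is nonnegative under (PM-ROOT) and row
2′TRI on the root side with `a₁ := u`** (type `2`): the orbit sum of `(q₀, q₁, q₁)` is
`2 · N_{τ[f:=2]} ≥ 4 · N_{τ[f:=3]} ≥ 0`. -/
theorem orbitRootS_pendant_root_nonneg_of_PMRoot (hPM : PMRoot R) {side : Fin 5 → Bool}
    {VL VH : Set V} {F : Finset E} {f : E} {u : V} (hf : ends f = s(mk 1, u))
    (hleaf : ∀ e, mk 1 ∈ ends e → e = f) (h1u : mk 1 ≠ u) (h1o : mk 1 ≠ mk 0)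
    (h12 : mk 1 ≠ mk 2) (h13 : mk 1 ≠ mk 3) (h1b : mk 1 ≠ mk 4) (huo : u ≠ mk 0)
    (hu2 : u ≠ mk 2) (hu3 : u ≠ mk 3) (hub : u ≠ mk 4) (hA : sideF ends VL F = {f}) (hfF : f ∈ F)
    (z : Config E) (τ : E → ℕ) (hτF : ∀ e ∈ F, τ e = 1 ∨ τ e = 2) (hτ : τ f = 2)
    (h : SepSplit ends mk σ side VL VH F z)
    (h3 : 0 ≤ typedCount F z (Function.update τ f 3)
      (K3 ends (mk 0) (mk 1) (mk 2) (mk 3) (mk 4) : Config E → Config E → Config E → R)) :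
    (0 : R) ≤ orbitRootS ends mk σ side VH (sideF ends VH F) z τ
      (pendData ends mk σ VL f z false, pendData ends mk σ VL f z true,
        pendData ends mk σ VL f z true) := by
  rw [orbitRootS_pendant_two ends mk σ hA z τ hτ h]
  have h2 := (typedCount_pendant_a1_of_PMRoot ends (mk 0) (mk 1) (mk 2) (mk 3) (mk 4) hPM hf hleaf
    h1u h1o h12 h13 h1b huo hu2 hu3 hub F hfF z τ hτF h3).2
  have hτ2 : Function.update τ f 2 = τ := by
    rw [← hτ]
    exact Function.update_eq_self f τ
  rw [hτ2] at h2
  exact mul_nonneg (by norm_num : (0 : R) ≤ 2) h2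

end Orbits

end TypedRed

end CovForm

end Summit.Ventures.PercRepro2
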